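import HarnessLib
import Summits.HodgeConjecture.Statement
import Literature.AlgebraicGeometry.Motives.Varieties
import Literature.AlgebraicGeometry.Motives.Sweep1
import Literature.AlgebraicGeometry.Motives.HodgeTensor
import Literature.AlgebraicGeometry.Motives.HodgeTensorFactsHolds
import Literature.AlgebraicGeometry.Motives.FamiliesVHS
import Literature.AlgebraicGeometry.HodgeTheory.HodgeConjecture
import Literature.AlgebraicGeometry.HodgeTheory.BettiUniverseAxioms
import Literature.AlgebraicGeometry.HodgeTheory.ComplexConjugationHolds
import Literature.AlgebraicGeometry.HodgeTheory.LefschetzOneOne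
import Literature.AlgebraicGeometry.HodgeTheory.AlgebraicMonodromyMumfordTate
import Literature.AlgebraicGeometry.HodgeTheory.FibrewiseDeckRelations
import Literature.AlgebraicGeometry.HodgeTheory.QuaternionicQuarticCover
import Literature.AlgebraicGeometry.HodgeTheory.QuaternionicQuarticFamily
import Literature.AlgebraicGeometry.HodgeTheory.QuaternionicQuarticDeckChart
import Literature.AlgebraicGeometry.HodgeTheory.QuaternionicQuarticDeckChartAction
import Literature.Algebra.Lie.KatzRecognitionTheorems
import Literature.Algebra.Lie.KatzRecognitionAddenda
import Summits.HodgeConjecture.HodgeConjecture.Theses.Q8SymplecticPowers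
import Summits.HodgeConjecture.HodgeConjecture.Theorems.Q8BireflectionGroupDensity

/-!
# Route `Q8SymplecticPowers`, crux K1Q — stub `stub_bqCoreQ` (S3 of line «mechanism-v2») DISCHARGED

The registered skeleton v2 «mechanism-v2» of crux `VeryGeneralQuaternionCommutatorsInHg` (item stmt-HodgeConjecture-24190, planner
hodge-nonav-p3 g36, 2026-08-29) has seven stubs; S3 `stub_bqCoreQ` — BQ-CORE over `ℂ`: a quaternionic group of `Q`-isometries
commuting with `a, b`, STRONGLY irreducible on `M = ker(a − i)` (`dim M ≥ 6`) and containing one `(i, −i)`-bireflection, has every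
`Q`-isometry commuting with `a, b` in the identity component of its Zariski closure, GIVEN Katz's recognition theorems 1.4 (both
forms), 1.5 and Remark 1.4.1 as named facts — is, binder for binder, the landed theorem
`Theorems.Q8BireflectionGroupDensity.mem_glIdentityComponent_of_bireflection` (prover-Ax g17, p717787). This file proves the stub BY
NAME AND VERBATIM SIGNATURE (the skeleton's `open … in` header included, whence the import list) so the skeleton check credits it.
HONEST FRAME: the four Katz facts stay hypotheses; S4 (END^ét_e), S5 (LOC6_e) and the other stubs are open; K1Q ∕ HC are NOT
proved. No sorries, no new axioms.
-/

set_option linter.dupNamespace false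

namespace Summit.HodgeConjecture.HodgeConjecture.Theorems.Q8SymplecticPowersStubBqCoreQ

/-- Registered stub `stub_bqCoreQ` (S3) of the K1Q skeleton «mechanism-v2», discharged by
`Q8BireflectionGroupDensity.mem_glIdentityComponent_of_bireflection` (conditional on the four displayed Katz named facts). -/
theorem stub_bqCoreQ :
    open Literature.AlgebraicGeometry.Motives Literature.AlgebraicGeometry.HodgeTheory Literature.AlgebraicGeometry.HodgeTheory.BettiUniverse Literature.AlgebraicGeometry.HodgeTheory.Q8Family Literature.AlgebraicGeometry.RelativeSpec Literature.AlgebraicGeometry.RelativeSpec.ActionOver Literature.Algebra.Lie Literature.Algebra.Lie.KatzRecognition CategoryTheory CategoryTheory.Limits MonoidalCategory CartesianMonoidalCategory AlgebraicGeometry in ∀ (h14 : Katz1990_thm14_gabber_of_ne) (h14' : Katz1990_thm14_gabber_dim8) (h15 : Katz1990_thm15_pseudoreflection) (h141 : Katz1990_rmk141_nonsimple) {V : Type} [AddCommGroup V] [Module ℂ V] [FiniteDimensional ℂ V] {Q : LinearMap.BilinForm ℂ V}, (∀ x y, Q x y = Q y x) → Q.Nondegenerate → ∀ {a b : V →ₗ[ℂ]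 V}, (∀ x, a (a x) = -x) → (∀ x, b (b x) = -x) → (∀ x, a (b x) = -b (a x)) → (∀ x y, Q (a x) (a y) = Q x y) → (∀ x y, Q (b x) (b y) = Q x y) → ∀ {i : ℂ}, i * i = -1 → 6 ≤ Module.finrank ℂ (Module.End.eigenspace a i) → ∀ {Γ : Subgroup (V ≃ₗ[ℂ] V)}, (∀ γ ∈ Γ, ∀ x, γ (a x) = a (γ x)) → (∀ γ ∈ Γ, ∀ x, γ (b x) = b (γ x)) → (∀ γ ∈ Γ, ∀ x y, Q (γ x) (γ y) = Q x y) → (∀ Γ' : Subgroup (V ≃ₗ[ℂ] V), Γ' ≤ Γ → (Γ'.subgroupOf Γ).FiniteIndex → ∀ F : Submodule ℂ V, F ≤ Module.End.eigenspace a i → (∀ γ ∈ Γ', ∀ x ∈ F, γ x ∈ F) → F = ⊥ ∨ F = Module.End.eigenspace a i) → (∃ γ ∈ Γ, ∃ ℓp ℓm : V, a ℓp = i • ℓp ∧ a ℓm = i • ℓm ∧ Q ℓp (b ℓm) ≠ 0 ∧ γ ℓp = i • ℓp ∧ γ ℓm = (-i) • ℓm ∧ ∀ x, a x = i • x → Q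 x (b ℓp) = 0 → Q x (b ℓm) = 0 → γ x = x) → ∀ {g : V ≃ₗ[ℂ] V}, (∀ x, g (a x) = a (g x)) → (∀ x, g (b x) = b (g x)) → (∀ x y, Q (g x) (g y) = Q x y) → g ∈ glIdentityComponent Γ := by
  intro h14 h14' h15 h141 V _ _ _ Q hQs hQn a b haa hbb hab haQ hQb i hi hM Γ hΓa hΓb hΓQ h_sirr h_bi g hga hgb hgQ
  exact Summit.HodgeConjecture.HodgeConjecture.Theorems.Q8BireflectionGroupDensity.mem_glIdentityComponent_of_bireflection h14
    h14' h15 h141 hQs hQn haa hbb hab haQ hQb hi hM hΓa hΓb hΓQ h_sirr h_bi hga hgb hgQ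

end Summit.HodgeConjecture.HodgeConjecture.Theorems.Q8SymplecticPowersStubBqCoreQ
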